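import Mathlib

/-!
# Clause 13-J/13-R, model step C7b (CLAUSE SCALING, ball / near-field / band pieces)

Route `FilamentSkeletonRss`, ∃-side clause 13 (`Clause13RNearStraightL`, stmt-NavierStokesRegularity-23612; typing-agnostic); design
`filament-plan/DESIGN-28296-model-L2closed-and-Linfty-g17.md` §2.  Companion of `…Clause13ScalingBounds`: the same elementary bookkeeping for the
BALL piece (`α₁ ≤ 32qC²/(θ₀²g)` Γ-free, `δ₁ ≤ 1/2400 + R_b·M_δ₁` — the only place where the smallness of `R_b` is spent; `θ = θ₀/R` with
`θ₀ = π√q/(4800(C²+1))` makes the cut-off commutator term exactly `2C²/(4800(C²+1)) ≤ 1/2400`), the NEAR-FIELD piece (`α₂ ≤ 64qC²/g`,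
`δ₂ ≤ M_δ₂/t`) and the two BAND pieces (`α₃, δ₃ ≤ M/t`), in the atoms `t = Γ^{1/8}`, `s = log Γ`, `g t⁸ ≤ G`, `R = R_b t⁴√s`, `x_s = 1/t`,
`log(1/x_s) = s/8 ≤ log(2/x_s)`, `L₁ + L₂ ≤ l/t²`.  Pure real inequalities, no analysis.
Lane ns-filament-19175-p1 g17; `--supports stmt-NavierStokesRegularity-23612 --as helper`.
HONEST FRAMING: bookkeeping about an explicit 1-D model operator attached to a HYPOTHETICAL filament skeleton on the NEGATIVE side of a MODEL route;
nothing here bears on Navier–Stokes regularity or blow-up.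
-/

noncomputable section

open Real

namespace Summit.NavierStokesRegularity.NavierStokesRegularity.Theorems.MatchedKernel
set_option linter.dupNamespace false

/-- BALL piece, common facts: `θ, gS0 > 0`, `R² = R_b² t⁸ s`, `1/gS0 ≤ 16/(g t⁸ s)`, `q/θ²·(2/gS0) ≤ 32 q R_b²/(θ₀² g)`. -/
theorem scl_ball_aux {q g t s G R Rb lg1 gS0 θ θ₀ : ℝ} (hq : 0 < q) (hg : 0 < g) (ht : 1 ≤ t) (hs : 1 ≤ s)
    (hG : g * t ^ 8 ≤ G) (hRb : 0 < Rb) (hR : R = Rb * t ^ 4 * Real.sqrt s) (hlg1 : lg1 = s / 8)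
    (egS0 : gS0 = G * (1 / 2 * lg1)) (hθ₀0 : 0 < θ₀) (hθ : θ = θ₀ / R) :
    0 < R ∧ 0 < θ ∧ 0 < gS0 ∧ R ^ 2 = Rb ^ 2 * t ^ 8 * s ∧ q / θ ^ 2 = q * R ^ 2 / θ₀ ^ 2 ∧
      1 / gS0 ≤ 16 / (g * t ^ 8 * s) ∧ q / θ ^ 2 * (2 / gS0) ≤ 32 * q * Rb ^ 2 / (θ₀ ^ 2 * g) := by
  have ht0 : 0 < t := by linarith
  have hs0 : 0 < s := by linarith
  have hss0 : 0 < Real.sqrt s := Real.sqrt_pos.2 hs0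
  have hR0 : 0 < R := by rw [hR]; positivity
  have hθ0 : 0 < θ := by rw [hθ]; positivity
  have egS : gS0 = G * s / 16 := by rw [egS0, hlg1]; ring
  have hgS0 : g * t ^ 8 * s / 16 ≤ gS0 := by
    rw [egS]; exact div_le_div_of_nonneg_right (by nlinarith [mul_le_mul_of_nonneg_right hG hs0.le]) (by norm_num)
  have hgS00 : 0 < gS0 := lt_of_lt_of_le (by positivity) hgS0
  have hR2 : R ^ 2 = Rb ^ 2 * t ^ 8 * s := by rw [hR, mul_pow, mul_pow, Real.sq_sqrt hs0.le]; ring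
  have hinv : 1 / gS0 ≤ 16 / (g * t ^ 8 * s) := by
    calc 1 / gS0 ≤ 1 / (g * t ^ 8 * s / 16) := div_le_div_of_nonneg_left zero_le_one (by positivity) hgS0
      _ = 16 / (g * t ^ 8 * s) := by rw [div_div_eq_mul_div, one_mul]
  have eqθ : q / θ ^ 2 = q * R ^ 2 / θ₀ ^ 2 := by rw [hθ, div_pow, div_div_eq_mul_div]
  refine ⟨hR0, hθ0, hgS00, hR2, eqθ, hinv, ?_⟩
  rw [eqθ]
  calc q * R ^ 2 / θ₀ ^ 2 * (2 / gS0) = q * R ^ 2 / θ₀ ^ 2 * 2 * (1 / gS0) := by ring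
    _ ≤ q * R ^ 2 / θ₀ ^ 2 * 2 * (16 / (g * t ^ 8 * s)) := mul_le_mul_of_nonneg_left hinv (by positivity)
    _ = 32 * q * Rb ^ 2 / (θ₀ ^ 2 * g) := by rw [hR2]; field_simp; ring

/-- BALL piece, the cut-off commutator term: `θ/(π√q)·C²·2R = 2C²/(4800(C²+1)) ≤ 1/2400`. -/
theorem scl_ball_T1 {C q R θ θ₀ : ℝ} (hq : 0 < q) (hR0 : 0 < R) (hθ₀ : θ₀ = Real.pi * √q / (4800 * (C ^ 2 + 1)))
    (hθ : θ = θ₀ / R) : θ / (Real.pi * √q) * C ^ 2 * (2 * R) ≤ 1 / 2400 := by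
  have hπ := Real.pi_pos
  have hsq : 0 < √q := Real.sqrt_pos.2 hq
  have e : θ / (Real.pi * √q) * C ^ 2 * (2 * R) = 2 * C ^ 2 / (4800 * (C ^ 2 + 1)) := by
    rw [hθ, hθ₀]; field_simp
  rw [e, div_le_div_iff₀ (by positivity) (by norm_num)]
  nlinarith [sq_nonneg C]

/-- BALL piece, the squared weight: `(C R + C√q t)² ≤ C²·2(1+q) t⁸ s` (`R_b ≤ 1`). -/
theorem scl_ball_sq {C q t s R Rb xs : ℝ} (hq : 0 < q) (ht : 1 ≤ t) (hs : 1 ≤ s) (hRb : 0 < Rb) (hRb1 : Rb ≤ 1)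
    (hR2 : R ^ 2 = Rb ^ 2 * t ^ 8 * s) (hxs : xs = 1 / t) :
    (C * R + C * √q / xs) ^ 2 ≤ C ^ 2 * (2 * (1 + q) * t ^ 8 * s) := by
  have ht0 : 0 < t := by linarith
  have hxs' : C * √q / xs = C * √q * t := by rw [hxs, div_div_eq_mul_div, div_one]
  rw [hxs']
  have e : (C * R + C * √q * t) ^ 2 = C ^ 2 * (R + √q * t) ^ 2 := by ring
  rw [e]
  refine mul_le_mul_of_nonneg_left ?_ (sq_nonneg _)
  have h1 : (R + √q * t) ^ 2 ≤ 2 * R ^ 2 + 2 * (√q * t) ^ 2 := by nlinarith [sq_nonneg (R - √q * t)]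
  have h2 : (√q * t) ^ 2 = q * t ^ 2 := by rw [mul_pow, Real.sq_sqrt hq.le]
  have h3 : t ^ 2 ≤ t ^ 8 * s := by
    calc t ^ 2 ≤ t ^ 8 := pow_le_pow_right₀ ht (by norm_num)
      _ = t ^ 8 * 1 := by ring
      _ ≤ t ^ 8 * s := by gcongr
  have h4 : Rb ^ 2 * t ^ 8 * s ≤ 1 * t ^ 8 * s := by gcongr; nlinarith
  rw [h2, hR2] at h1
  nlinarith [h1, mul_le_mul_of_nonneg_left h3 hq.le, h4]

set_option maxHeartbeats 400000 in
/-- BALL piece: `α₁ ≤ 32qC²/(θ₀²g)` and `δ₁ ≤ 1/2400 + R_b·M_δ₁` (`θ = θ₀/R`, `θ₀ = π√q/(4800(C²+1))`, `x_s = 1/t`). -/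
theorem scl_delta1 {C q g Λ l b₁ b₂ t s G R Rb xs lg1 gS0 θ θ₀ L₁ L₂ α₁ δ₁ : ℝ} (hC : 0 ≤ C) (hq : 0 < q) (hg : 0 < g)
    (hΛ : 0 ≤ Λ) (hl : 0 ≤ l) (hb₁ : 0 ≤ b₁) (hb₂ : 0 ≤ b₂) (ht : 1 ≤ t) (hs : 1 ≤ s) (hG : g * t ^ 8 ≤ G) (hRb : 0 < Rb)
    (hRb1 : Rb ≤ 1) (hR : R = Rb * t ^ 4 * Real.sqrt s) (hxs : xs = 1 / t) (hlg1 : lg1 = s / 8) (egS0 : gS0 = G * (1 / 2 * lg1))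
    (hθ₀ : θ₀ = Real.pi * √q / (4800 * (C ^ 2 + 1))) (hθ : θ = θ₀ / R) (hL₁ : 0 ≤ L₁) (hL₂ : 0 ≤ L₂)
    (hL : L₁ + L₂ ≤ l / t ^ 2) (eα₁ : α₁ = q / θ ^ 2 * (2 / gS0) * C ^ 2)
    (eδ₁ : δ₁ = θ / (Real.pi * √q) * C ^ 2 * (2 * R)
      + q / θ ^ 2 * (2 / gS0 * ((Λ * (C + C) + (L₁ + L₂) * (C * √q / xs)) * C + (b₁ + b₂) * C ^ 2)
        + Λ ^ 2 / gS0 ^ 2 * (2 * (C * R + (C * √q / xs)) ^ 2))) :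
    0 < θ ∧ 0 < gS0 ∧ 0 ≤ α₁ ∧ α₁ ≤ 32 * q * C ^ 2 / (θ₀ ^ 2 * g) ∧ 0 ≤ δ₁ ∧
      δ₁ ≤ 1 / 2400 + Rb * (32 * q * (2 * Λ + l * √q + b₁ + b₂) * C ^ 2 / (θ₀ ^ 2 * g)
        + 1024 * q * Λ ^ 2 * C ^ 2 * (1 + q) / (θ₀ ^ 2 * g ^ 2)) := by
  have ht0 : 0 < t := by linarith
  have hs0 : 0 < s := by linarith
  have hπ := Real.pi_pos
  have hsq : 0 < √q := Real.sqrt_pos.2 hq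
  have hθ₀0 : 0 < θ₀ := by rw [hθ₀]; positivity
  obtain ⟨hR0, hθ0, hgS00, hR2, eqθ, hinv, hQ⟩ := scl_ball_aux hq hg ht hs hG hRb hR hlg1 egS0 hθ₀0 hθ
  have hRb2 : Rb ^ 2 ≤ Rb := by nlinarith
  have hxs' : C * √q / xs = C * √q * t := by rw [hxs, div_div_eq_mul_div, div_one]
  have hxs0 : 0 < xs := by rw [hxs]; positivity
  refine ⟨hθ0, hgS00, by rw [eα₁]; positivity, ?_, by rw [eδ₁]; positivity, ?_⟩
  · rw [eα₁]
    calc q / θ ^ 2 * (2 / gS0) * C ^ 2 ≤ 32 * q * Rb ^ 2 / (θ₀ ^ 2 * g) * C ^ 2 := mul_le_mul_of_nonneg_right hQ (sq_nonneg _)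
      _ = 32 * q * C ^ 2 / (θ₀ ^ 2 * g) * Rb ^ 2 := by ring
      _ ≤ 32 * q * C ^ 2 / (θ₀ ^ 2 * g) * 1 := mul_le_mul_of_nonneg_left (hRb2.trans hRb1) (by positivity)
      _ = _ := by ring
  have hT1 := scl_ball_T1 (C := C) hq hR0 hθ₀ hθ
  -- the `L`-term
  have hLt : (L₁ + L₂) * t ≤ l :=
    calc (L₁ + L₂) * t ≤ l / t ^ 2 * t := mul_le_mul_of_nonneg_right hL ht0.le
      _ = l / t := by field_simp
      _ ≤ l := div_le_self hl ht
  -- T2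
  have hinner : (Λ * (C + C) + (L₁ + L₂) * (C * √q / xs)) * C + (b₁ + b₂) * C ^ 2 ≤ (2 * Λ + l * √q + b₁ + b₂) * C ^ 2 := by
    rw [hxs']
    have h1 : (L₁ + L₂) * (C * √q * t) ≤ l * (C * √q) := by
      calc (L₁ + L₂) * (C * √q * t) = ((L₁ + L₂) * t) * (C * √q) := by ring
        _ ≤ l * (C * √q) := mul_le_mul_of_nonneg_right hLt (by positivity)
    linarith only [mul_le_mul_of_nonneg_right h1 hC]
  have hinner0 : 0 ≤ (Λ * (C + C) + (L₁ + L₂) * (C * √q / xs)) * C + (b₁ + b₂) * C ^ 2 := by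
    have : 0 ≤ L₁ + L₂ := by linarith
    positivity
  have hT2 : q / θ ^ 2 * (2 / gS0 * ((Λ * (C + C) + (L₁ + L₂) * (C * √q / xs)) * C + (b₁ + b₂) * C ^ 2))
      ≤ Rb * (32 * q * (2 * Λ + l * √q + b₁ + b₂) * C ^ 2 / (θ₀ ^ 2 * g)) := by
    calc q / θ ^ 2 * (2 / gS0 * ((Λ * (C + C) + (L₁ + L₂) * (C * √q / xs)) * C + (b₁ + b₂) * C ^ 2))
        = (q / θ ^ 2 * (2 / gS0)) * (((Λ * (C + C) + (L₁ + L₂) * (C * √q / xs)) * C + (b₁ + b₂) * C ^ 2)) := by ring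
      _ ≤ (32 * q * Rb ^ 2 / (θ₀ ^ 2 * g)) * ((2 * Λ + l * √q + b₁ + b₂) * C ^ 2) :=
          mul_le_mul hQ hinner hinner0 (by positivity)
      _ = Rb ^ 2 * (32 * q * (2 * Λ + l * √q + b₁ + b₂) * C ^ 2 / (θ₀ ^ 2 * g)) := by ring
      _ ≤ Rb * (32 * q * (2 * Λ + l * √q + b₁ + b₂) * C ^ 2 / (θ₀ ^ 2 * g)) :=
          mul_le_mul_of_nonneg_right hRb2 (by positivity)
  -- T3
  have hsq2 := scl_ball_sq (C := C) hq ht hs hRb hRb1 hR2 hxs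
  have hinv2 : 1 / gS0 ^ 2 ≤ (16 / (g * t ^ 8 * s)) ^ 2 := by
    rw [one_div, ← inv_pow, ← one_div]; exact pow_le_pow_left₀ (by positivity) hinv 2
  have hT3 : q / θ ^ 2 * (Λ ^ 2 / gS0 ^ 2 * (2 * (C * R + C * √q / xs) ^ 2))
      ≤ Rb * (1024 * q * Λ ^ 2 * C ^ 2 * (1 + q) / (θ₀ ^ 2 * g ^ 2)) := by
    calc q / θ ^ 2 * (Λ ^ 2 / gS0 ^ 2 * (2 * (C * R + C * √q / xs) ^ 2))
        = (q * R ^ 2 / θ₀ ^ 2 * Λ ^ 2 * 2) * ((1 / gS0 ^ 2) * (C * R + C * √q / xs) ^ 2) := by rw [eqθ]; ring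
      _ ≤ (q * R ^ 2 / θ₀ ^ 2 * Λ ^ 2 * 2) * ((16 / (g * t ^ 8 * s)) ^ 2 * (C ^ 2 * (2 * (1 + q) * t ^ 8 * s))) := by
          refine mul_le_mul_of_nonneg_left ?_ (by positivity)
          exact mul_le_mul hinv2 hsq2 (sq_nonneg _) (by positivity)
      _ = Rb ^ 2 * (1024 * q * Λ ^ 2 * C ^ 2 * (1 + q) / (θ₀ ^ 2 * g ^ 2)) := by rw [hR2]; field_simp; ring
      _ ≤ Rb * (1024 * q * Λ ^ 2 * C ^ 2 * (1 + q) / (θ₀ ^ 2 * g ^ 2)) := mul_le_mul_of_nonneg_right hRb2 (by positivity)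
  rw [eδ₁, mul_add (q / θ ^ 2), mul_add Rb]
  linarith

/-- NEAR-FIELD piece, denominator and numerator bounds (`x_s = 1/t`, `log(2/x_s) ≥ s/8`). -/
theorem scl_near_aux {C q g Λ l b₁ b₂ t s G R Rb xs lg2 L₁ L₂ : ℝ} (hC : 0 ≤ C) (hq : 0 < q) (hg : 0 < g) (hΛ : 0 ≤ Λ)
    (hl : 0 ≤ l) (ht : 1 ≤ t) (hs : 1 ≤ s) (hG : g * t ^ 8 ≤ G) (hRb : 0 ≤ Rb) (hRb1 : Rb ≤ 1)
    (hR : R = Rb * t ^ 4 * Real.sqrt s) (hxs : xs = 1 / t) (hlg2 : s / 8 ≤ lg2) (hL : L₁ + L₂ ≤ l / t ^ 2) :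
    0 < g * t ^ 6 * s / (64 * q) ∧ g * t ^ 6 * s / (64 * q) ≤ G * (2 / q * (xs ^ 2 / 16 * lg2)) ∧
      Λ * (C + C) + (L₁ + L₂) * (C * √q / xs) + (b₁ + b₂) * C + Real.sqrt 2 * Λ * C ≤ (4 * Λ + l * √q + b₁ + b₂) * C ∧
      Real.sqrt 2 * Λ * (C / √q) * R ≤ 2 * Λ * C * t ^ 4 * s / √q ∧ C * √q / xs = C * √q * t := by
  have ht0 : 0 < t := by linarith
  have hs0 : 0 < s := by linarith
  have hG0 : 0 < G := lt_of_lt_of_le (by positivity) hG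
  have h2 : Real.sqrt 2 ≤ 2 := by rw [Real.sqrt_le_left (by norm_num)]; norm_num
  have hsq : 0 < √q := Real.sqrt_pos.2 hq
  have hss : Real.sqrt s ≤ s := by rw [Real.sqrt_le_left (by linarith)]; nlinarith
  have hD : g * t ^ 6 * s / (64 * q) ≤ G * (2 / q * (xs ^ 2 / 16 * lg2)) := by
    rw [hxs]
    calc g * t ^ 6 * s / (64 * q) = (g * t ^ 8) * (2 / q * ((1 / t) ^ 2 / 16 * (s / 8))) := by field_simp; ring
      _ ≤ G * (2 / q * ((1 / t) ^ 2 / 16 * lg2)) := by gcongr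
  have hxs' : C * √q / xs = C * √q * t := by rw [hxs, div_div_eq_mul_div, div_one]
  have hLt : (L₁ + L₂) * t ≤ l :=
    calc (L₁ + L₂) * t ≤ l / t ^ 2 * t := mul_le_mul_of_nonneg_right hL ht0.le
      _ = l / t := by field_simp
      _ ≤ l := div_le_self hl ht
  refine ⟨by positivity, hD, ?_, ?_, hxs'⟩
  · rw [hxs']
    have hA : (L₁ + L₂) * (C * √q * t) ≤ l * (C * √q) := by
      calc (L₁ + L₂) * (C * √q * t) = ((L₁ + L₂) * t) * (C * √q) := by ring
        _ ≤ l * (C * √q) := mul_le_mul_of_nonneg_right hLt (by positivity)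
    have hΛC := mul_nonneg hΛ hC
    linarith only [hA, mul_le_mul_of_nonneg_right h2 hΛC]
  · rw [hR]
    calc Real.sqrt 2 * Λ * (C / √q) * (Rb * t ^ 4 * Real.sqrt s) = Real.sqrt 2 * Rb * Real.sqrt s * (Λ * C * t ^ 4 / √q) := by ring
      _ ≤ 2 * 1 * s * (Λ * C * t ^ 4 / √q) := by gcongr
      _ = _ := by ring

/-- NEAR-FIELD piece: `α₂ ≤ 64qC²/g`, `δ₂ ≤ M_δ₂/t` (`x_s = 1/t`, `log(2/x_s) ≥ s/8`). -/
theorem scl_delta2 {C q g Λ l b₁ b₂ t s G R Rb xs lg2 L₁ L₂ α₂ δ₂ : ℝ} (hC : 0 ≤ C) (hq : 0 < q) (hg : 0 < g) (hΛ : 0 ≤ Λ)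
    (hl : 0 ≤ l) (hb₁ : 0 ≤ b₁) (hb₂ : 0 ≤ b₂) (ht : 1 ≤ t) (hs : 1 ≤ s) (hG : g * t ^ 8 ≤ G) (hRb : 0 ≤ Rb) (hRb1 : Rb ≤ 1)
    (hR : R = Rb * t ^ 4 * Real.sqrt s) (hxs : xs = 1 / t) (hlg2 : s / 8 ≤ lg2) (hL₁ : 0 ≤ L₁) (hL₂ : 0 ≤ L₂)
    (hL : L₁ + L₂ ≤ l / t ^ 2) (eα₂ : α₂ = C ^ 2 / (G * (2 / q * (xs ^ 2 / 16 * lg2))))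
    (eδ₂ : δ₂ = ((Λ * (C + C) + (L₁ + L₂) * (C * √q / xs) + (b₁ + b₂) * C + Real.sqrt 2 * Λ * C)
      + Real.sqrt 2 * Λ * (C / √q) * R) * C / (G * (2 / q * (xs ^ 2 / 16 * lg2)))) :
    0 ≤ α₂ ∧ α₂ ≤ 64 * q * C ^ 2 / g ∧ 0 ≤ δ₂ ∧
      δ₂ ≤ (64 * q * (4 * Λ + l * √q + b₁ + b₂) * C ^ 2 / g + 128 * Λ * C ^ 2 * √q / g) / t := by
  obtain ⟨hD0, hD, hN1, hN2, hxs'⟩ := scl_near_aux (b₁ := b₁) (b₂ := b₂) hC hq hg hΛ hl ht hs hG hRb hRb1 hR hxs hlg2 hL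
  have ht0 : 0 < t := by linarith
  have hs0 : 0 < s := by linarith
  have hsq : 0 < √q := Real.sqrt_pos.2 hq
  have hR0 : 0 ≤ R := by rw [hR]; positivity
  have hL0 : 0 ≤ L₁ + L₂ := by linarith
  have hden0 : 0 < G * (2 / q * (xs ^ 2 / 16 * lg2)) := lt_of_lt_of_le hD0 hD
  refine ⟨by rw [eα₂]; exact div_nonneg (sq_nonneg _) hden0.le, ?_,
    by rw [eδ₂, hxs']; exact div_nonneg (by positivity) hden0.le, ?_⟩
  · rw [eα₂]
    calc C ^ 2 / (G * (2 / q * (xs ^ 2 / 16 * lg2))) ≤ C ^ 2 / (g * t ^ 6 * s / (64 * q)) :=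
          div_le_div_of_nonneg_left (sq_nonneg _) hD0 hD
      _ = 64 * q * C ^ 2 / g * (1 / (t ^ 6 * s)) := by field_simp
      _ ≤ 64 * q * C ^ 2 / g * 1 := by
          refine mul_le_mul_of_nonneg_left ?_ (by positivity)
          rw [div_le_one (by positivity)]; nlinarith [one_le_pow₀ (M₀ := ℝ) ht (n := 6)]
      _ = _ := by ring
  rw [eδ₂]
  have hA : (Λ * (C + C) + (L₁ + L₂) * (C * √q / xs) + (b₁ + b₂) * C + Real.sqrt 2 * Λ * C) * C / (G * (2 / q * (xs ^ 2 / 16 * lg2)))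
      ≤ (4 * Λ + l * √q + b₁ + b₂) * C * C / (g * t ^ 6 * s / (64 * q)) :=
    div_le_div₀ (by positivity) (mul_le_mul_of_nonneg_right hN1 hC) hD0 hD
  have hB : Real.sqrt 2 * Λ * (C / √q) * R * C / (G * (2 / q * (xs ^ 2 / 16 * lg2)))
      ≤ (2 * Λ * C * t ^ 4 * s / √q) * C / (g * t ^ 6 * s / (64 * q)) :=
    div_le_div₀ (by positivity) (mul_le_mul_of_nonneg_right hN2 hC) hD0 hD
  have eA : (4 * Λ + l * √q + b₁ + b₂) * C * C / (g * t ^ 6 * s / (64 * q))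
      = 64 * q * (4 * Λ + l * √q + b₁ + b₂) * C ^ 2 / g * (1 / (t ^ 6 * s)) := by field_simp
  have eB : (2 * Λ * C * t ^ 4 * s / √q) * C / (g * t ^ 6 * s / (64 * q)) = 128 * Λ * C ^ 2 * (q / √q) / g * (1 / t ^ 2) := by
    field_simp; ring
  have hA' : 64 * q * (4 * Λ + l * √q + b₁ + b₂) * C ^ 2 / g * (1 / (t ^ 6 * s))
      ≤ 64 * q * (4 * Λ + l * √q + b₁ + b₂) * C ^ 2 / g / t := by
    rw [div_eq_mul_one_div _ t]
    refine mul_le_mul_of_nonneg_left (div_le_div_of_nonneg_left zero_le_one ht0 ?_) (by positivity)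
    calc t ≤ t ^ 6 := le_self_pow₀ ht (by norm_num)
      _ = t ^ 6 * 1 := by ring
      _ ≤ t ^ 6 * s := by gcongr
  have hB' : 128 * Λ * C ^ 2 * (q / √q) / g * (1 / t ^ 2) ≤ 128 * Λ * C ^ 2 * √q / g / t := by
    rw [Real.div_sqrt, div_eq_mul_one_div (128 * Λ * C ^ 2 * √q / g) t]
    refine mul_le_mul_of_nonneg_left ?_ (by positivity)
    exact div_le_div_of_nonneg_left zero_le_one ht0 (le_self_pow₀ ht (by norm_num))
  have esplit : ((Λ * (C + C) + (L₁ + L₂) * (C * √q / xs) + (b₁ + b₂) * C + Real.sqrt 2 * Λ * C)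
      + Real.sqrt 2 * Λ * (C / √q) * R) * C / (G * (2 / q * (xs ^ 2 / 16 * lg2)))
      = (Λ * (C + C) + (L₁ + L₂) * (C * √q / xs) + (b₁ + b₂) * C + Real.sqrt 2 * Λ * C) * C / (G * (2 / q * (xs ^ 2 / 16 * lg2)))
        + Real.sqrt 2 * Λ * (C / √q) * R * C / (G * (2 / q * (xs ^ 2 / 16 * lg2))) := by ring
  rw [esplit, add_div]
  rw [eA] at hA; rw [eB] at hB
  exact add_le_add (hA.trans hA') (hB.trans hB')

/-- BAND pieces: `α₃ ≤ M_α₃/t`, `δ₃ ≤ M_δ₃/t`. -/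
theorem scl_delta3 {C q g Λ l b₁ b₂ t s G R Rb L₁ L₂ α₃ δ₃ : ℝ} (hC : 0 ≤ C) (hq : 0 < q) (hg : 0 < g) (hΛ : 0 ≤ Λ)
    (hl : 0 ≤ l) (hb₁ : 0 ≤ b₁) (hb₂ : 0 ≤ b₂) (ht : 1 ≤ t) (hs : 1 ≤ s) (hst : s ≤ 8 * t) (hG : g * t ^ 8 ≤ G) (hRb : 0 ≤ Rb)
    (hRb1 : Rb ≤ 1) (hR : R = Rb * t ^ 4 * Real.sqrt s) (hL₁ : 0 ≤ L₁) (hL₂ : 0 ≤ L₂) (hL : L₁ + L₂ ≤ l / t ^ 2)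
    (eα₃ : α₃ = √q * (Real.sqrt 2 * ((C + C) * R + ((C * √q) + (C * √q)))) * (C + C) / (G * (153 / 4000)))
    (eδ₃ : δ₃ = √q * (Real.sqrt 2 * ((C + C) * R + ((C * √q) + (C * √q))))
      * (Λ * ((C + C) + (C + C)) + (L₁ + L₂) * ((C * √q) + (C * √q)) + (Λ + b₁ + 3 * b₂) * (C + C)) / (G * (153 / 4000))) :
    0 ≤ α₃ ∧ α₃ ≤ 216 * √q * C ^ 2 * (8 + √q) / g / t ∧ 0 ≤ δ₃ ∧
      δ₃ ≤ 216 * √q * C ^ 2 * (8 + √q) * (3 * Λ + l * √q + b₁ + 3 * b₂) / g / t := by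
  have ht0 : 0 < t := by linarith
  have hs0 : 0 < s := by linarith
  have hG0 : 0 < G := lt_of_lt_of_le (by positivity) hG
  have h2 : Real.sqrt 2 ≤ 2 := by rw [Real.sqrt_le_left (by norm_num)]; norm_num
  have hsq : 0 ≤ √q := Real.sqrt_nonneg q
  have hss : Real.sqrt s ≤ s := by rw [Real.sqrt_le_left (by linarith)]; nlinarith
  have hR0 : 0 ≤ R := by rw [hR]; positivity
  have hLl : L₁ + L₂ ≤ l := hL.trans (div_le_self hl (one_le_pow₀ ht))
  have hL0 : 0 ≤ L₁ + L₂ := by linarith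
  have ht5 : (1 : ℝ) ≤ t ^ 5 := one_le_pow₀ ht
  -- the prefactor
  have hRle : R ≤ 8 * t ^ 5 := by
    rw [hR]
    calc Rb * t ^ 4 * Real.sqrt s ≤ 1 * t ^ 4 * (8 * t) :=
          mul_le_mul (mul_le_mul_of_nonneg_right hRb1 (by positivity)) (hss.trans hst) (Real.sqrt_nonneg _) (by positivity)
      _ = 8 * t ^ 5 := by ring
  have hpre : √q * (Real.sqrt 2 * ((C + C) * R + ((C * √q) + (C * √q)))) ≤ 4 * √q * C * (8 + √q) * t ^ 5 := by
    have h1 : (C + C) * R + ((C * √q) + (C * √q)) ≤ 2 * C * (8 + √q) * t ^ 5 := by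
      have := mul_le_mul_of_nonneg_left hRle hC
      have := mul_le_mul_of_nonneg_left ht5 (mul_nonneg hC hsq)
      nlinarith
    calc √q * (Real.sqrt 2 * ((C + C) * R + ((C * √q) + (C * √q))))
        = √q * Real.sqrt 2 * ((C + C) * R + ((C * √q) + (C * √q))) := by ring
      _ ≤ √q * 2 * (2 * C * (8 + √q) * t ^ 5) := mul_le_mul (by gcongr) h1 (by positivity) (by positivity)
      _ = _ := by ring
  have hpre0 : 0 ≤ √q * (Real.sqrt 2 * ((C + C) * R + ((C * √q) + (C * √q)))) := by positivity
  have hden : g * t ^ 8 * (153 / 4000) ≤ G * (153 / 4000) := by gcongr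
  have hden0 : 0 < g * t ^ 8 * (153 / 4000) := by positivity
  have hfrac : t ^ 5 / (g * t ^ 8 * (153 / 4000)) ≤ 27 / g / t := by
    rw [div_div, div_le_div_iff₀ hden0 (by positivity)]
    have : t ^ 5 * (g * t) * 4000 ≤ 27 * (g * t ^ 8 * 153) := by
      have h6 : t ^ 6 ≤ t ^ 8 := pow_le_pow_right₀ ht (by norm_num)
      nlinarith [mul_le_mul_of_nonneg_left h6 hg.le, pow_pos ht0 6]
    linarith
  refine ⟨by rw [eα₃]; positivity, ?_, by rw [eδ₃]; positivity, ?_⟩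
  · rw [eα₃]
    calc √q * (Real.sqrt 2 * ((C + C) * R + ((C * √q) + (C * √q)))) * (C + C) / (G * (153 / 4000))
        ≤ 4 * √q * C * (8 + √q) * t ^ 5 * (C + C) / (g * t ^ 8 * (153 / 4000)) :=
          div_le_div₀ (by positivity) (mul_le_mul_of_nonneg_right hpre (by positivity)) hden0 hden
      _ = 8 * √q * C ^ 2 * (8 + √q) * (t ^ 5 / (g * t ^ 8 * (153 / 4000))) := by ring
      _ ≤ 8 * √q * C ^ 2 * (8 + √q) * (27 / g / t) := mul_le_mul_of_nonneg_left hfrac (by positivity)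
      _ = _ := by ring
  · have hmid : Λ * ((C + C) + (C + C)) + (L₁ + L₂) * ((C * √q) + (C * √q)) + (Λ + b₁ + 3 * b₂) * (C + C)
        ≤ 2 * C * (3 * Λ + l * √q + b₁ + 3 * b₂) := by
      nlinarith [mul_le_mul_of_nonneg_right hLl (mul_nonneg hC hsq)]
    have hmid0 : 0 ≤ Λ * ((C + C) + (C + C)) + (L₁ + L₂) * ((C * √q) + (C * √q)) + (Λ + b₁ + 3 * b₂) * (C + C) := by
      positivity
    rw [eδ₃]
    calc √q * (Real.sqrt 2 * ((C + C) * R + ((C * √q) + (C * √q))))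
          * (Λ * ((C + C) + (C + C)) + (L₁ + L₂) * ((C * √q) + (C * √q)) + (Λ + b₁ + 3 * b₂) * (C + C)) / (G * (153 / 4000))
        ≤ 4 * √q * C * (8 + √q) * t ^ 5 * (2 * C * (3 * Λ + l * √q + b₁ + 3 * b₂)) / (g * t ^ 8 * (153 / 4000)) :=
          div_le_div₀ (by positivity) (mul_le_mul hpre hmid hmid0 (by positivity)) hden0 hden
      _ = 8 * √q * C ^ 2 * (8 + √q) * (3 * Λ + l * √q + b₁ + 3 * b₂) * (t ^ 5 / (g * t ^ 8 * (153 / 4000))) := by ring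
      _ ≤ 8 * √q * C ^ 2 * (8 + √q) * (3 * Λ + l * √q + b₁ + 3 * b₂) * (27 / g / t) :=
          mul_le_mul_of_nonneg_left hfrac (by positivity)
      _ = _ := by ring

end Summit.NavierStokesRegularity.NavierStokesRegularity.Theorems.MatchedKernel
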